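import Mathlib
import HarnessLib
import Summits.Ventures.LatticeQCDFlow.Scaling.NonEquilibrium
import Summits.Ventures.LatticeQCDFlow.Scaling.AnnealingStepLaw

/-!
# LatticeQCDFlow / Scaling — the step-count optimum of Jarzynski samplers WITH the per-evolution
# overhead (`n_between` + measurement): the Eff-optimal ESS is above `1/e`, and the printed `1/e`
# rule costs at most the factor `e^{B/(c+B)}`

HONEST FRAMING: exact (Metropolis-corrected) sampling algorithms for lattice gauge theory;
figures of merit are autocorrelation/cost numbers at stated couplings and volumes; no
continuum-physics claim.

Venture `LatticeQCDFlow` (cell pub-lqcd), topic `Scaling`; FANOUT row 19 (`su2-snf`, GEN-3: family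
C = defect / OBC→PBC non-equilibrium evolutions of 4D SU(2), levers `protocol.n_step`,
`protocol.n_between`).  OUR WORK, elementary real analysis; nothing is cited as a fact.  It extends
item T2-F `Scaling/NonEquilibrium.lean` (`Theory2.nstep_cost_lower_bound`: `n·e^{c/n} ≥ e·c`,
optimum `n = c`, `ESS = 1/e`), which types the printed rule of Bonanno et al., arXiv:2510.25704 §4
eq. (4.3)–(4.4): minimising `n_step/ESS = n_step·exp(k′ n_dof/n_step)` gives "`ESS_best = 1/e`,
architecture-independent" — obtained there, in the paper's words, "completely neglecting
`n_between`".  The paper's own figure of merit (ibid. eq. (4.1)–(4.2), and arXiv:2402.06561 §3.4) is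
`Eff = Var(O)·(n_step + n_between)/ESS`: every evolution also pays the `n_between` prior sweeps
between launches (and the measurements), an OVERHEAD `B ≥ 0` in protocol-step units that does not
improve `ESS`.  This file minimises the full expression EXACTLY.

## The model and the law (`c = k′·n_dof > 0`, `B ≥ 0`, cost per effectively independent
## configuration `f(n) = (n + B)·e^{c/n} = (n + B)/ESS(n)` with the printed `ESS(n) = e^{−c/n}`)

* §1 `overhead_cost_ge_linear` — `e·c + B ≤ f(n)` for every `n > 0` (T2-F plus `e^{c/n} ≥ 1`).
* §2 THE OPTIMUM is the positive root `m` of **`m² = c·m + c·B`**, i.e. `m = (c + √(c² + 4cB))/2`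
  (`overhead_root_spec`; unique, `overhead_root_unique`): **`overhead_cost_ge_optimum`** —
  `f(m) ≤ f(n)` for every `n > 0`, by ONE convexity inequality `e^{a} ≥ e^{b}(1 + a − b)` and the
  algebraic identity `(n + B)(1 + c/n − c/m) = (m + B) + cB(n − m)²/(n m²)` on the root.
  Window: **`c ≤ m ≤ c + B`** (`overhead_root_ge`, `overhead_root_le`), `m = c ↔ B = 0`
  (`overhead_root_eq_iff`), and **`√(cB) ≤ m ≤ c + √(cB)`** (`overhead_root_ge_sqrt`,
  `overhead_root_le_add_sqrt`).
* §3 THE OPERATING ESS AT THE OPTIMUM, `ESS⋆ = e^{−c/m}`: **`1/e ≤ ESS⋆ ≤ e^{−c/(c+B)}`**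
  (`overhead_optimum_ess_ge`, `overhead_optimum_ess_le`), `ESS⋆ = 1/e ↔ B = 0`
  (`overhead_optimum_ess_eq_iff`), and for `B > 0`: `ESS⋆ ≥ e^{−√(c/B)}` (`overhead_optimum_ess_ge_sqrt`)
  — with overhead the Eff-optimal flows are BETTER than `1/e`, tending to `ESS⋆ → 1` when the
  overhead dominates the protocol (`B ≫ c`).
* §4 THE PRICE OF THE `1/e` RULE: running at the printed optimum `n = c` costs `e·(c + B)`
  (`overhead_cost_at_c`), and **`e·(c + B) ≤ e^{1 − c/m}·f(m) ≤ e^{B/(c+B)}·f(m)`**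
  (`overhead_cost_at_c_le`, `overhead_penalty_le`, `overhead_cost_at_c_le_penalty`, `overhead_penalty_lt`): never more than a factor
  `e^{B/(c+B)} < e` above the true optimum — `≈ 1 + B/c` for a small overhead, up to `e` for a
  dominant one.
* §5 THE OPTIMAL COST IS `Θ(c + B)`: **`e·c + B ≤ f(m) ≤ e·(c + 2B)`** (`overhead_optimum_cost_ge`,
  `overhead_optimum_cost_le`) — linear in `c = k′·n_dof` (T2-F) PLUS the overhead, which no choice
  of `n_step` amortises: per effectively independent configuration the `n_between` sweeps are paid
  in full.

* §6 THE CARD'S GRID `n_step ∈ {c/2, c, 2c}`: the half arm is never the cheapest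
  (`overhead_half_arm_gt`); the double arm beats the unit arm iff `(2 − √e)c < (√e − 1)B`
  (`overhead_double_arm_lt_iff`; `1 < √e < 2`, so the threshold is `B/c > (2 − √e)/(√e − 1)`).
* §7 WITHOUT THE EMPIRICAL LAW (`perfectRelaxation_overhead_cost_ge`): for every linear protocol on
  a finite space with PERFECTLY relaxing layers, variance floor `σ²` and overhead `B`, T2-AC
  (`Theory2.prod_ess_linProtocol_le`, `c = σ²(Δβ)²`) and AM–GM give **`ÊSS·(√c + √B)² ≤ n + B`**:
  the work per effectively independent path is at least `(√c + √B)² ≥ c + B`, derived not assumed.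
Reading for family C (value-free): with one full-lattice sweep per protocol step, `B = n_between +`
(measurement sweeps) is small against `c = k′ n_dof` at the card's grid, and §4 bounds what the
`1/e` grid rule can lose by `e^{B/(c+B)}`; for protocol steps CHEAPER than a prior sweep (the
registered defect-ball lever `protocol.sweep_region`, where `B` counted in protocol-step units is
large) §2–§3 move the optimum to longer protocols and `ESS⋆` well above `1/e`, and §4 says the `1/e`
rule may then cost up to a factor `e`.  The law `ESS(n) = e^{−c/n}` itself remains the empirical /
perturbative input of the cited papers (as in T2-F), not a theorem here; autocorrelation along the
restart chain (the other effect of `n_between`) is row 8's `Scoring/RestartChainAutocorrelation.lean`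
and is not restated.
-/

namespace Summit.Ventures.LatticeQCDFlow.Scaling

open Real

/-! ## §1 The trivial floor: the overhead is paid at least once -/

/-- **`e·c + B ≤ (n + B)·e^{c/n}`** for all `n > 0` (`c > 0`, `B ≥ 0`): T2-F plus `e^{c/n} ≥ 1`.
[ours] -/
theorem overhead_cost_ge_linear {c B n : ℝ} (hc : 0 < c) (hB : 0 ≤ B) (hn : 0 < n) :
    Real.exp 1 * c + B ≤ (n + B) * Real.exp (c / n) := by
  have h1 := Theory2.nstep_cost_lower_bound hc hn
  have h2 : 1 ≤ Real.exp (c / n) := by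
    have := Real.add_one_le_exp (c / n)
    have : 0 ≤ c / n := (div_pos hc hn).le
    linarith
  have h3 : B ≤ B * Real.exp (c / n) := by nlinarith
  calc Real.exp 1 * c + B ≤ n * Real.exp (c / n) + B * Real.exp (c / n) := add_le_add h1 h3
    _ = (n + B) * Real.exp (c / n) := by ring

/-! ## §2 The optimum: the positive root of `m² = c·m + c·B` -/

/-- The explicit positive root `m = (c + √(c² + 4cB))/2` of `m² = c·m + c·B`. [ours] -/
theorem overhead_root_spec {c B : ℝ} (hc : 0 < c) (hB : 0 ≤ B) :
    0 < (c + Real.sqrt (c ^ 2 + 4 * c * B)) / 2 ∧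
      ((c + Real.sqrt (c ^ 2 + 4 * c * B)) / 2) ^ 2 =
        c * ((c + Real.sqrt (c ^ 2 + 4 * c * B)) / 2) + c * B := by
  have hD : 0 ≤ c ^ 2 + 4 * c * B := by positivity
  have hs := Real.sq_sqrt hD
  have hs0 := Real.sqrt_nonneg (c ^ 2 + 4 * c * B)
  refine ⟨by positivity, ?_⟩
  linear_combination (1 / 4 : ℝ) * hs

/-- A positive root of `m² = c·m + c·B` is at least `c` (`B ≥ 0`). [ours] -/
theorem overhead_root_ge {c B m : ℝ} (hc : 0 < c) (hB : 0 ≤ B) (hm : 0 < m)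
    (hq : m ^ 2 = c * m + c * B) : c ≤ m := by
  nlinarith [mul_nonneg hc.le hB]

/-- … and at most `c + B`. [ours] -/
theorem overhead_root_le {c B m : ℝ} (hc : 0 < c) (hB : 0 ≤ B) (hm : 0 < m)
    (hq : m ^ 2 = c * m + c * B) : m ≤ c + B := by
  nlinarith [mul_nonneg hB (sub_nonneg.2 (overhead_root_ge hc hB hm hq))]

/-- The positive root is unique. [ours] -/
theorem overhead_root_unique {c B m m' : ℝ} (hc : 0 < c) (hB : 0 ≤ B) (hm : 0 < m)
    (hq : m ^ 2 = c * m + c * B) (hm' : 0 < m') (hq' : m' ^ 2 = c * m' + c * B) : m = m' := by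
  have h : (m - m') * (m + m' - c) = 0 := by linear_combination hq - hq'
  rcases mul_eq_zero.1 h with h | h
  · linarith
  · have h1 := overhead_root_ge hc hB hm hq
    have h2 := overhead_root_ge hc hB hm' hq'
    linarith

/-- The root equals `c` exactly when there is no overhead. [ours] -/
theorem overhead_root_eq_iff {c B m : ℝ} (hc : 0 < c) (hm : 0 < m) (hq : m ^ 2 = c * m + c * B) :
    m = c ↔ B = 0 := by
  constructor
  · intro h
    subst h
    have h1 : m * B = 0 := by linear_combination hq.symm
    rcases mul_eq_zero.1 h1 with h | h
    · exact absurd h hc.ne'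
    · exact h
  · intro h
    subst h
    have h1 : m * (m - c) = 0 := by linear_combination hq
    rcases mul_eq_zero.1 h1 with h | h
    · exact absurd h hm.ne'
    · linarith

/-- Large-overhead window, lower end: `√(c·B) ≤ m`. [ours] -/
theorem overhead_root_ge_sqrt {c B m : ℝ} (hc : 0 < c) (hm : 0 < m)
    (hq : m ^ 2 = c * m + c * B) : Real.sqrt (c * B) ≤ m := by
  have h : c * B ≤ m ^ 2 := by nlinarith
  calc Real.sqrt (c * B) ≤ Real.sqrt (m ^ 2) := Real.sqrt_le_sqrt h
    _ = m := Real.sqrt_sq hm.le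

/-- Large-overhead window, upper end: `m ≤ c + √(c·B)`. [ours] -/
theorem overhead_root_le_add_sqrt {c B m : ℝ} (hc : 0 < c) (hB : 0 ≤ B) (hm : 0 < m)
    (hq : m ^ 2 = c * m + c * B) : m ≤ c + Real.sqrt (c * B) := by
  set r := Real.sqrt (c * B) with hr
  have hr2 : r ^ 2 = c * B := Real.sq_sqrt (mul_nonneg hc.le hB)
  have hr0 : 0 ≤ r := Real.sqrt_nonneg _
  rcases le_or_gt m (c + r) with hle | hlt
  · exact hle
  · -- `m (m − c) = cB = r²`, but `m − c > r` and `m > r` force `m (m − c) > r²`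
    exfalso
    have h1 : r < m - c := by linarith
    have h2 : r < m := by linarith
    have h3 : m * (m - c) = r ^ 2 := by linear_combination hq - hr2
    nlinarith [mul_lt_mul_of_pos_left h1 hm, mul_le_mul_of_nonneg_right h2.le hr0]

/-- **THE OVERHEAD LAW.**  For `c > 0`, `B ≥ 0` and `m > 0` with `m² = c·m + c·B`:
`(m + B)·e^{c/m} ≤ (n + B)·e^{c/n}` for every `n > 0` — the cost per effectively independent
configuration `(n_step + B)/ESS(n_step)` is minimised at `n_step = m = (c + √(c² + 4cB))/2`, not at
the printed `n_step = c`.  Proof: `e^{c/n} ≥ e^{c/m}(1 + c/n − c/m)` and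
`(n + B)(1 + c/n − c/m) = (m + B) + cB(n − m)²/(n m²)`. [ours] -/
theorem overhead_cost_ge_optimum {c B m : ℝ} (hc : 0 < c) (hB : 0 ≤ B) (hm : 0 < m)
    (hq : m ^ 2 = c * m + c * B) {n : ℝ} (hn : 0 < n) :
    (m + B) * Real.exp (c / m) ≤ (n + B) * Real.exp (c / n) := by
  have hkey : (n + B) * (1 + c / n - c / m) = (m + B) + c * B * (n - m) ^ 2 / (n * m ^ 2) := by
    have hB' : B = (m ^ 2 - c * m) / c := by
      rw [eq_div_iff hc.ne']
      linear_combination -hq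
    subst hB'
    field_simp
    ring
  -- convexity of `exp` in supporting-line form: `e^{b}(1 + a − b) ≤ e^{a}`
  have hconv : Real.exp (c / m) * (1 + c / n - c / m) ≤ Real.exp (c / n) := by
    have h := Real.add_one_le_exp (c / n - c / m)
    calc Real.exp (c / m) * (1 + c / n - c / m) = Real.exp (c / m) * ((c / n - c / m) + 1) := by ring
      _ ≤ Real.exp (c / m) * Real.exp (c / n - c / m) :=
          mul_le_mul_of_nonneg_left h (Real.exp_pos _).le
      _ = Real.exp (c / n) := by rw [← Real.exp_add]; congr 1; ring
  have hnB : 0 ≤ n + B := by linarith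
  have hextra : 0 ≤ c * B * (n - m) ^ 2 / (n * m ^ 2) := by positivity
  calc (m + B) * Real.exp (c / m)
      ≤ ((m + B) + c * B * (n - m) ^ 2 / (n * m ^ 2)) * Real.exp (c / m) :=
        mul_le_mul_of_nonneg_right (by linarith) (Real.exp_pos _).le
    _ = (n + B) * (Real.exp (c / m) * (1 + c / n - c / m)) := by rw [← hkey]; ring
    _ ≤ (n + B) * Real.exp (c / n) := mul_le_mul_of_nonneg_left hconv hnB

/-- The optimum with the explicit root substituted: for every `n > 0`,
`(m + B)·e^{c/m} ≤ (n + B)·e^{c/n}` with `m = (c + √(c² + 4cB))/2`. [ours] -/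
theorem overhead_cost_ge_optimum_explicit {c B : ℝ} (hc : 0 < c) (hB : 0 ≤ B) {n : ℝ} (hn : 0 < n) :
    ((c + Real.sqrt (c ^ 2 + 4 * c * B)) / 2 + B) *
        Real.exp (c / ((c + Real.sqrt (c ^ 2 + 4 * c * B)) / 2)) ≤
      (n + B) * Real.exp (c / n) := by
  obtain ⟨hm, hq⟩ := overhead_root_spec hc hB
  exact overhead_cost_ge_optimum hc hB hm hq hn

/-! ## §3 The operating ESS at the optimum: `1/e ≤ e^{−c/m} ≤ e^{−c/(c+B)}` -/

/-- **`ESS⋆ ≥ 1/e`**: at the Eff-optimum the flow is at least as good as the printed `1/e`. [ours] -/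
theorem overhead_optimum_ess_ge {c B m : ℝ} (hc : 0 < c) (hB : 0 ≤ B) (hm : 0 < m)
    (hq : m ^ 2 = c * m + c * B) : Real.exp (-1) ≤ Real.exp (-(c / m)) := by
  have h := overhead_root_ge hc hB hm hq
  rw [Real.exp_le_exp, neg_le_neg_iff, div_le_one hm]
  exact h

/-- **`ESS⋆ ≤ e^{−c/(c+B)}`**. [ours] -/
theorem overhead_optimum_ess_le {c B m : ℝ} (hc : 0 < c) (hB : 0 ≤ B) (hm : 0 < m)
    (hq : m ^ 2 = c * m + c * B) : Real.exp (-(c / m)) ≤ Real.exp (-(c / (c + B))) := by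
  have h := overhead_root_le hc hB hm hq
  rw [Real.exp_le_exp, neg_le_neg_iff]
  exact div_le_div_of_nonneg_left hc.le hm h

/-- `ESS⋆ = 1/e` exactly when there is no overhead. [ours] -/
theorem overhead_optimum_ess_eq_iff {c B m : ℝ} (hc : 0 < c) (hm : 0 < m)
    (hq : m ^ 2 = c * m + c * B) : Real.exp (-(c / m)) = Real.exp (-1) ↔ B = 0 := by
  rw [Real.exp_eq_exp, neg_inj, div_eq_one_iff_eq hm.ne', eq_comm, overhead_root_eq_iff hc hm hq]

/-- **Dominant overhead drives the optimum towards `ESS⋆ → 1`**: for `B > 0`,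
`e^{−√(c/B)} ≤ ESS⋆` (from `m ≥ √(cB)`). [ours] -/
theorem overhead_optimum_ess_ge_sqrt {c B m : ℝ} (hc : 0 < c) (hB : 0 < B) (hm : 0 < m)
    (hq : m ^ 2 = c * m + c * B) : Real.exp (-Real.sqrt (c / B)) ≤ Real.exp (-(c / m)) := by
  have hcm : 0 ≤ c / m := (div_pos hc hm).le
  have hsq : (c / m) ^ 2 ≤ c / B := by
    have h : c * B ≤ m ^ 2 := by nlinarith
    rw [div_pow, div_le_div_iff₀ (by positivity) hB]
    nlinarith [mul_le_mul_of_nonneg_left h hc.le]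
  have h : c / m ≤ Real.sqrt (c / B) := (Real.le_sqrt hcm (div_pos hc hB).le).2 hsq
  rw [Real.exp_le_exp, neg_le_neg_iff]
  exact h

/-! ## §4 The price of the printed `1/e` rule -/

/-- Running at the printed optimum `n = c` (`ESS = 1/e`) costs `e·(c + B)`. [ours] -/
theorem overhead_cost_at_c {c B : ℝ} (hc : c ≠ 0) :
    (c + B) * Real.exp (c / c) = Real.exp 1 * (c + B) := by
  rw [div_self hc, mul_comm]

/-- **The `1/e` rule is within the factor `e^{1 − c/m}` of the optimum**:
`e·(c + B) ≤ e^{1 − c/m}·((m + B)·e^{c/m})` (because `c ≤ m`). [ours] -/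
theorem overhead_cost_at_c_le {c B m : ℝ} (hc : 0 < c) (hB : 0 ≤ B) (hm : 0 < m)
    (hq : m ^ 2 = c * m + c * B) :
    (c + B) * Real.exp (c / c) ≤ Real.exp (1 - c / m) * ((m + B) * Real.exp (c / m)) := by
  have h := overhead_root_ge hc hB hm hq
  have hexp : Real.exp (1 - c / m) * Real.exp (c / m) = Real.exp 1 := by
    rw [← Real.exp_add]; congr 1; ring
  calc (c + B) * Real.exp (c / c) = Real.exp 1 * (c + B) := overhead_cost_at_c hc.ne'
    _ ≤ Real.exp 1 * (m + B) := mul_le_mul_of_nonneg_left (by linarith) (Real.exp_pos 1).le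
    _ = Real.exp (1 - c / m) * ((m + B) * Real.exp (c / m)) := by rw [← hexp]; ring

/-- **… and that factor is at most `e^{B/(c+B)}`** (because `m ≤ c + B`). [ours] -/
theorem overhead_penalty_le {c B m : ℝ} (hc : 0 < c) (hB : 0 ≤ B) (hm : 0 < m)
    (hq : m ^ 2 = c * m + c * B) : Real.exp (1 - c / m) ≤ Real.exp (B / (c + B)) := by
  have h := overhead_root_le hc hB hm hq
  have hcB : 0 < c + B := by linarith
  have h1 : c / (c + B) ≤ c / m := div_le_div_of_nonneg_left hc.le hm h
  have h2 : B / (c + B) = 1 - c / (c + B) := by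
    field_simp
    ring
  rw [Real.exp_le_exp, h2]
  linarith

/-- **The two steps combined**: `e·(c + B) ≤ e^{B/(c+B)} · ((m + B)·e^{c/m})` — the cost of the
printed `ESS = 1/e` operating point exceeds the optimal cost by at most the factor `e^{B/(c+B)}`.
[ours] -/
theorem overhead_cost_at_c_le_penalty {c B m : ℝ} (hc : 0 < c) (hB : 0 ≤ B) (hm : 0 < m)
    (hq : m ^ 2 = c * m + c * B) :
    (c + B) * Real.exp (c / c) ≤ Real.exp (B / (c + B)) * ((m + B) * Real.exp (c / m)) :=
  (overhead_cost_at_c_le hc hB hm hq).trans (mul_le_mul_of_nonneg_right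
    (overhead_penalty_le hc hB hm hq) (by positivity))

/-- The penalty factor is strictly below `e` for every finite overhead. [ours] -/
theorem overhead_penalty_lt {c B : ℝ} (hc : 0 < c) (hB : 0 ≤ B) :
    Real.exp (B / (c + B)) < Real.exp 1 := by
  have hcB : 0 < c + B := by linarith
  rw [Real.exp_lt_exp, div_lt_one hcB]
  linarith

/-! ## §5 The optimal cost is `Θ(c + B)` -/

/-- **Floor at the optimum**: `e·c + B ≤ (m + B)·e^{c/m}`. [ours] -/
theorem overhead_optimum_cost_ge {c B m : ℝ} (hc : 0 < c) (hB : 0 ≤ B) (hm : 0 < m) :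
    Real.exp 1 * c + B ≤ (m + B) * Real.exp (c / m) :=
  overhead_cost_ge_linear hc hB hm

/-- **Ceiling at the optimum**: `(m + B)·e^{c/m} ≤ e·(c + 2B)` (`c/m ≤ 1`, `m ≤ c + B`): together
with the floor, the optimal cost per effectively independent configuration is LINEAR in
`c + B = k′·n_dof + overhead`. [ours] -/
theorem overhead_optimum_cost_le {c B m : ℝ} (hc : 0 < c) (hB : 0 ≤ B) (hm : 0 < m)
    (hq : m ^ 2 = c * m + c * B) : (m + B) * Real.exp (c / m) ≤ Real.exp 1 * (c + 2 * B) := by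
  have h1 := overhead_root_ge hc hB hm hq
  have h2 := overhead_root_le hc hB hm hq
  have hexp : Real.exp (c / m) ≤ Real.exp 1 := by
    rw [Real.exp_le_exp, div_le_one hm]
    exact h1
  have hmB : 0 ≤ m + B := by linarith
  calc (m + B) * Real.exp (c / m) ≤ (m + B) * Real.exp 1 := mul_le_mul_of_nonneg_left hexp hmB
    _ ≤ (c + 2 * B) * Real.exp 1 :=
        mul_le_mul_of_nonneg_right (by linarith) (Real.exp_pos 1).le
    _ = Real.exp 1 * (c + 2 * B) := mul_comm _ _

/-! ## §6 The card's three-arm grid `n_step ∈ {c/2, c, 2c}` under overhead -/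

/-- **The half arm is never the cheapest**: `(c + B)·e^{c/c} < (c/2 + B)·e^{c/(c/2)}` for every
`B ≥ 0` (it reads `e(c + B) < e²(c/2 + B)`, i.e. `0 < (e/2 − 1)c + (e − 1)B`). [ours] -/
theorem overhead_half_arm_gt {c B : ℝ} (hc : 0 < c) (hB : 0 ≤ B) :
    (c + B) * Real.exp (c / c) < (c / 2 + B) * Real.exp (c / (c / 2)) := by
  have h2 : c / (c / 2) = 2 := by field_simp
  rw [div_self hc.ne', h2]
  have he : (2 : ℝ) < Real.exp 1 := by
    have := Real.exp_one_gt_d9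
    linarith
  have hexp2 : Real.exp 2 = Real.exp 1 * Real.exp 1 := by rw [← Real.exp_add]; norm_num
  rw [hexp2]
  have he0 := Real.exp_pos (1 : ℝ)
  nlinarith [mul_pos he0 hc, mul_nonneg he0.le hB]

/-- **The double arm beats the unit arm exactly when the overhead is large enough**:
`(2c + B)·e^{c/(2c)} < (c + B)·e^{c/c} ↔ (2 − √e)·c < (√e − 1)·B` — with `√e = e^{1/2}`, i.e.
`B/c > (2 − √e)/(√e − 1)`. [ours] -/
theorem overhead_double_arm_lt_iff {c B : ℝ} (hc : 0 < c) :
    (2 * c + B) * Real.exp (c / (2 * c)) < (c + B) * Real.exp (c / c) ↔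
      (2 - Real.exp (1 / 2)) * c < (Real.exp (1 / 2) - 1) * B := by
  have h2 : c / (2 * c) = 1 / 2 := by field_simp
  have hexp1 : Real.exp 1 = Real.exp (1 / 2) * Real.exp (1 / 2) := by
    rw [← Real.exp_add]; norm_num
  rw [div_self hc.ne', h2, hexp1]
  have hr := Real.exp_pos (1 / 2 : ℝ)
  constructor
  · intro h
    -- divide `(2c + B)·r < (c + B)·r²` by `r > 0`
    have h' : 2 * c + B < (c + B) * Real.exp (1 / 2) := by
      by_contra hle
      push Not at hle
      have := mul_le_mul_of_nonneg_right hle hr.le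
      nlinarith
    nlinarith
  · intro h
    have h' : 2 * c + B < (c + B) * Real.exp (1 / 2) := by nlinarith
    have := mul_lt_mul_of_pos_right h' hr
    nlinarith

/-! ## §7 Without the empirical law: perfect relaxation, T2-AC plus AM–GM -/

/-- AM–GM in the form used: `(√c + √B)² ≤ (n + B)·(1 + c/n)` for `n > 0`, `c, B ≥ 0` (the
difference is `(n − √c√B)²/n`). [ours] -/
theorem sqrt_add_sqrt_sq_le_overhead_cost {c B n : ℝ} (hc : 0 ≤ c) (hB : 0 ≤ B) (hn : 0 < n) :
    (Real.sqrt c + Real.sqrt B) ^ 2 ≤ (n + B) * (1 + c / n) := by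
  have hsc := Real.sq_sqrt hc
  have hsB := Real.sq_sqrt hB
  have hs0 := Real.sqrt_nonneg c
  have ht0 := Real.sqrt_nonneg B
  have hexp : (n + B) * (1 + c / n) = n + c + B + c * B / n := by
    field_simp
    ring
  have hsq : (Real.sqrt c + Real.sqrt B) ^ 2 = c + B + 2 * (Real.sqrt c * Real.sqrt B) := by
    nlinarith [hsc, hsB]
  have hcB : c * B = (Real.sqrt c * Real.sqrt B) ^ 2 := by rw [mul_pow, hsc, hsB]
  have hkey : n + c * B / n - 2 * (Real.sqrt c * Real.sqrt B) =
      (n - Real.sqrt c * Real.sqrt B) ^ 2 / n := by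
    rw [hcB]
    field_simp
    ring
  have hnn : 0 ≤ (n - Real.sqrt c * Real.sqrt B) ^ 2 / n := by positivity
  rw [hexp, hsq]
  linarith

open Theory2 Exactness in
/-- **T2-AC WITH OVERHEAD (a theorem of the model, no empirical law).**  For ANY linear protocol
`S_k = β_k·A` on a finite space with perfectly relaxing layers, an action-variance floor
`Var_{β_k}(A) ≥ σ² ≥ 0` along the path and an overhead `B ≥ 0` per path: writing
`c = σ²(β_n − β_0)²` and `ÊSS = Π_k ESS(p_{k+1}, p_k)` (`≤ 1/(1 + c/n)`, T2-AC),
**`ÊSS · (√c + √B)² ≤ n + B`** — the work per `ÊSS`-weighted path, `(n + B)/ÊSS`, is at least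
`(√c + √B)² = c + B + 2√(cB)` WHATEVER the number of steps: the overhead and the variance term do
not add, their square roots do. [ours] -/
theorem perfectRelaxation_overhead_cost_ge {X : Type*} [Fintype X] [Nonempty X] (β : ℕ → ℝ)
    (A : X → ℝ) {n : ℕ} (hn : 0 < n) {σ2 : ℝ} (hσ0 : 0 ≤ σ2)
    (hσ : ∀ k : Fin n, σ2 ≤ varLaw (gibbsLaw (linProtocol β A n k.succ)) A) {B : ℝ} (hB : 0 ≤ B) :
    (∏ k : Fin n, essFrac (gibbsLaw (linProtocol β A n k.succ))
        (gibbsLaw (linProtocol β A n k.castSucc))) *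
      (Real.sqrt (σ2 * (β n - β 0) ^ 2) + Real.sqrt B) ^ 2 ≤ n + B := by
  have hηle := prod_ess_linProtocol_le β A n hσ0 hσ
  have hc : 0 ≤ σ2 * (β n - β 0) ^ 2 := by positivity
  have hn' : (0 : ℝ) < n := Nat.cast_pos.2 hn
  have hamgm := sqrt_add_sqrt_sq_le_overhead_cost hc hB hn'
  have hpos : 0 < 1 + σ2 * (β n - β 0) ^ 2 / n := by positivity
  calc (∏ k : Fin n, essFrac (gibbsLaw (linProtocol β A n k.succ))
          (gibbsLaw (linProtocol β A n k.castSucc))) *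
        (Real.sqrt (σ2 * (β n - β 0) ^ 2) + Real.sqrt B) ^ 2
      ≤ (1 + σ2 * (β n - β 0) ^ 2 / n)⁻¹ * ((n + B) * (1 + σ2 * (β n - β 0) ^ 2 / n)) :=
        mul_le_mul hηle hamgm (sq_nonneg _) (inv_nonneg.2 hpos.le)
    _ = n + B := by field_simp

end Summit.Ventures.LatticeQCDFlow.Scaling
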